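import Summits.AtomisticToContinuum.Crystallization.Theorems.HullExactificationCascadeExactHcpLocalTheoremPropagation

/-!
# Route HullExactificationCascade — item `ExactHcpLocalTheorem` (G), helper 7: layers

Helper file 7 for `stmt-AtomisticToContinuum-12093`.  Filling a hexagon layer from one of its points
(`plane_fill_even` for clusters `N`, `plane_fill_odd` for twin clusters `halfTurn '' N`, by the
in-layer steps along `±u, ±v`), and the four interlayer moves (up/down from an even-type or an
odd-type layer), as in Hales, *Dense Sphere Packings* §1.3 ("a single hexagonal layer forces a
hexagonal layer above and another below"), here with exact clusters instead of tangency.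
[folklore]
-/

noncomputable section

namespace Summit.AtomisticToContinuum.Crystallization.Theorems.ExactHcpLocal

open Literature.MathematicalPhysics.StatisticalMechanics

variable {a h : ℝ}

/-! ## Layers file: filling the hexagon layers and stacking them -/

section Layers

open RealInnerProductSpace Literature.Geometry.DiscreteGeometry

/-- `σ_h` and the half-turn commute. [folklore] -/
theorem mirrorH_halfTurn_comm (x : EuclideanSpace ℝ (Fin 3)) :
    (ℝ ∙ layerNormal h)ᗮ.reflection (halfTurn x) = halfTurn ((ℝ ∙ layerNormal h)ᗮ.reflection x) := by
  rw [mirror_apply, mirror_apply, map_sub, LinearIsometryEquiv.map_smul]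
  have h1 : halfTurn (layerNormal h) = layerNormal h := by
    rw [halfTurn_apply]; ext l; fin_cases l <;> simp [layerNormal]
  have h2 : ⟪layerNormal h, halfTurn x⟫ = ⟪layerNormal h, x⟫ := by
    rw [inner_fin3, inner_fin3, halfTurn_apply]; simp [layerNormal]
  rw [h1, h2]

/-- `σ_h` maps the twin cluster to itself. [folklore] -/
theorem mirrorH_image_twin (hh : h ≠ 0) :
    (ℝ ∙ layerNormal h)ᗮ.reflection '' (halfTurn ''
        {p : EuclideanSpace ℝ (Fin 3) | p ∈ hcpStacking a h ∧ ‖p‖ < 13 / 10 * a}) =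
      halfTurn '' {p : EuclideanSpace ℝ (Fin 3) | p ∈ hcpStacking a h ∧ ‖p‖ < 13 / 10 * a} := by
  rw [Set.image_image]
  have : (fun x => (ℝ ∙ layerNormal h)ᗮ.reflection (halfTurn x)) =
      fun x => halfTurn ((ℝ ∙ layerNormal h)ᗮ.reflection x) := funext mirrorH_halfTurn_comm
  rw [this, ← Set.image_image (f := fun x => (ℝ ∙ layerNormal h)ᗮ.reflection x),
    image_cluster_eq_of_mem_iff (mirrorH_mem_iff hh)]

/-- The half-turn is an involution on sets. [folklore] -/
theorem halfTurn_image_image (M : Set (EuclideanSpace ℝ (Fin 3))) : halfTurn '' (halfTurn '' M) = M := by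
  rw [Set.image_image]
  have : (fun x => halfTurn (halfTurn x)) = id := by
    funext x; rw [halfTurn_apply, halfTurn_apply]; exact halfTurnFun_involutive x
  rw [this, Set.image_id]

/-- The half-turn negates the hexagon layer: `halfTurn (𝔰 0 i j) = 𝔰 0 (−i) (−j)`. [folklore] -/
theorem halfTurn_site_zero (i j : ℤ) :
    halfTurn (barlowPos a h alternatingHagg 0 i j) = barlowPos a h alternatingHagg 0 (-i) (-j) := by
  rw [halfTurn_site]
  norm_num
  rw [site_sub_of_odd odd_one]
  all_goals norm_num

/-! ### Filling a hexagon layer from one of its points -/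

/-- **Filling a layer.** If clusters of type `M` propagate along `±u` and `±v`, then from one
point `c` with cluster `M` the whole translated triangular lattice `c + ℤu + ℤv` has clusters
`M`. [folklore] -/
theorem plane_fill {S M : Set (EuclideanSpace ℝ (Fin 3))}
    (stepU : ∀ z : EuclideanSpace ℝ (Fin 3), S ∩ Metric.ball z (13 / 10 * a) = (fun n => z + n) '' M →
      S ∩ Metric.ball (z + barlowPos a h alternatingHagg 0 1 0) (13 / 10 * a) =
        (fun n => z + barlowPos a h alternatingHagg 0 1 0 + n) '' M)
    (stepU' : ∀ z : EuclideanSpace ℝ (Fin 3), S ∩ Metric.ball z (13 / 10 * a) = (fun n => z + n) '' M →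
      S ∩ Metric.ball (z + barlowPos a h alternatingHagg 0 (-1) 0) (13 / 10 * a) =
        (fun n => z + barlowPos a h alternatingHagg 0 (-1) 0 + n) '' M)
    (stepV : ∀ z : EuclideanSpace ℝ (Fin 3), S ∩ Metric.ball z (13 / 10 * a) = (fun n => z + n) '' M →
      S ∩ Metric.ball (z + barlowPos a h alternatingHagg 0 0 1) (13 / 10 * a) =
        (fun n => z + barlowPos a h alternatingHagg 0 0 1 + n) '' M)
    (stepV' : ∀ z : EuclideanSpace ℝ (Fin 3), S ∩ Metric.ball z (13 / 10 * a) = (fun n => z + n) '' M →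
      S ∩ Metric.ball (z + barlowPos a h alternatingHagg 0 0 (-1)) (13 / 10 * a) =
        (fun n => z + barlowPos a h alternatingHagg 0 0 (-1) + n) '' M)
    {c : EuclideanSpace ℝ (Fin 3)} (hc : S ∩ Metric.ball c (13 / 10 * a) = (fun n => c + n) '' M)
    (i j : ℤ) :
    S ∩ Metric.ball (c + barlowPos a h alternatingHagg 0 i j) (13 / 10 * a) =
      (fun n => c + barlowPos a h alternatingHagg 0 i j + n) '' M := by
  have row : ∀ i : ℤ, S ∩ Metric.ball (c + barlowPos a h alternatingHagg 0 i 0) (13 / 10 * a) =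
      (fun n => c + barlowPos a h alternatingHagg 0 i 0 + n) '' M := by
    intro i
    induction i using Int.induction_on with
    | zero => simpa [barlowPos_alternating_zero] using hc
    | succ i ih =>
      have e : c + barlowPos a h alternatingHagg 0 i 0 + barlowPos a h alternatingHagg 0 1 0 =
          c + barlowPos a h alternatingHagg 0 ((i : ℤ) + 1) 0 := by
        rw [add_assoc, hcp_add_of_even a h Even.zero]; simp
      have := stepU _ ih
      rwa [e] at this
    | pred i ih =>
      have e : c + barlowPos a h alternatingHagg 0 (-(i : ℤ)) 0 + barlowPos a h alternatingHagg 0 (-1) 0 =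
          c + barlowPos a h alternatingHagg 0 (-(i : ℤ) - 1) 0 := by
        rw [add_assoc, hcp_add_of_even a h Even.zero]
        congr 2
      have := stepU' _ ih
      rwa [e] at this
  induction j using Int.induction_on with
  | zero => exact row i
  | succ j ih =>
    have e : c + barlowPos a h alternatingHagg 0 i j + barlowPos a h alternatingHagg 0 0 1 =
        c + barlowPos a h alternatingHagg 0 i ((j : ℤ) + 1) := by
      rw [add_assoc, hcp_add_of_even a h Even.zero]; simp
    have := stepV _ ih
    rwa [e] at this
  | pred j ih =>
    have e : c + barlowPos a h alternatingHagg 0 i (-(j : ℤ)) + barlowPos a h alternatingHagg 0 0 (-1) =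
        c + barlowPos a h alternatingHagg 0 i (-(j : ℤ) - 1) := by
      rw [add_assoc, hcp_add_of_even a h Even.zero]
      congr 2
      all_goals ring
    have := stepV' _ ih
    rwa [e] at this

/-- **Filling an even-type layer** (clusters `N`): the four steps are `inLayer_step_conj` for the
symmetries `1, M_u, M_{u−v}, M_{u−v} ∘ M_u` of the cluster. [folklore] -/
theorem plane_fill_even (ha : 0 < a) (hh : 0 < h) (hh1 : 64 / 100 * a ^ 2 < h ^ 2)
    (hh2 : h ^ 2 < 69 / 100 * a ^ 2) {S : Set (EuclideanSpace ℝ (Fin 3))}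
    (hS : ∀ y ∈ S, ∃ A : EuclideanSpace ℝ (Fin 3) ≃ₗᵢ[ℝ] EuclideanSpace ℝ (Fin 3),
      S ∩ Metric.ball y (13 / 10 * a) = (fun n => y + A n) ''
        {p : EuclideanSpace ℝ (Fin 3) | p ∈ hcpStacking a h ∧ ‖p‖ < 13 / 10 * a})
    {c : EuclideanSpace ℝ (Fin 3)}
    (hc : S ∩ Metric.ball c (13 / 10 * a) = (fun n => c + n) ''
      {p : EuclideanSpace ℝ (Fin 3) | p ∈ hcpStacking a h ∧ ‖p‖ < 13 / 10 * a}) (i j : ℤ) :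
    S ∩ Metric.ball (c + barlowPos a h alternatingHagg 0 i j) (13 / 10 * a) =
      (fun n => c + barlowPos a h alternatingHagg 0 i j + n) ''
        {p : EuclideanSpace ℝ (Fin 3) | p ∈ hcpStacking a h ∧ ‖p‖ < 13 / 10 * a} := by
  set N := {p : EuclideanSpace ℝ (Fin 3) | p ∈ hcpStacking a h ∧ ‖p‖ < 13 / 10 * a} with hN
  set Mu := (ℝ ∙ barlowPos a h alternatingHagg 0 1 0)ᗮ.reflection with hMu
  set Muv := (ℝ ∙ (barlowPos a h alternatingHagg 0 1 0 - barlowPos a h alternatingHagg 0 0 1))ᗮ.reflection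
    with hMuv
  have hU : ∀ x, Mu x ∈ hcpStacking a h ↔ x ∈ hcpStacking a h := mirrorU_mem_iff ha.ne'
  have hUV : ∀ x, Muv x ∈ hcpStacking a h ↔ x ∈ hcpStacking a h := mirrorUV_mem_iff ha.ne'
  have hL0 : haggLabel alternatingHagg 0 = 0 := haggLabel_zero _
  -- the generic step
  have step : ∀ g : EuclideanSpace ℝ (Fin 3) ≃ₗᵢ[ℝ] EuclideanSpace ℝ (Fin 3),
      (∀ x, g x ∈ hcpStacking a h ↔ x ∈ hcpStacking a h) →
      ∀ z : EuclideanSpace ℝ (Fin 3), S ∩ Metric.ball z (13 / 10 * a) = (fun n => z + n) '' N →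
        S ∩ Metric.ball (z + g (barlowPos a h alternatingHagg 0 1 0)) (13 / 10 * a) =
          (fun n => z + g (barlowPos a h alternatingHagg 0 1 0) + n) '' N := by
    intro g hg z hz
    have hgN : g '' N = N := image_cluster_eq_of_mem_iff hg _
    have := inLayer_step_conj ha hh hh1 hh2 g hS (z := z) (by rw [hgN]; exact hz)
    rwa [hgN] at this
  refine plane_fill (M := N) ?_ ?_ ?_ ?_ hc i j
  · intro z hz
    simpa using step (LinearIsometryEquiv.refl ℝ _) (fun x => Iff.rfl) z hz
  · intro z hz
    have e : Mu (barlowPos a h alternatingHagg 0 1 0) = barlowPos a h alternatingHagg 0 (-1) 0 := by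
      rw [hMu, mirrorU_site ha.ne', hL0]; norm_num
    simpa [e] using step Mu hU z hz
  · intro z hz
    have e : Muv (barlowPos a h alternatingHagg 0 1 0) = barlowPos a h alternatingHagg 0 0 1 := by
      rw [hMuv, mirrorUV_site ha.ne']
    simpa [e] using step Muv hUV z hz
  · intro z hz
    have e : (Mu.trans Muv) (barlowPos a h alternatingHagg 0 1 0) = barlowPos a h alternatingHagg 0 0 (-1) := by
      rw [LinearIsometryEquiv.trans_apply, hMu, mirrorU_site ha.ne', hL0, hMuv, mirrorUV_site ha.ne']
      norm_num
    simpa [e] using step (Mu.trans Muv) (trans_mem_iff hU hUV) z hz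

/-- **Filling an odd-type layer** (clusters `halfTurn '' N`): the same steps conjugated by the
half-turn. [folklore] -/
theorem plane_fill_odd (ha : 0 < a) (hh : 0 < h) (hh1 : 64 / 100 * a ^ 2 < h ^ 2)
    (hh2 : h ^ 2 < 69 / 100 * a ^ 2) {S : Set (EuclideanSpace ℝ (Fin 3))}
    (hS : ∀ y ∈ S, ∃ A : EuclideanSpace ℝ (Fin 3) ≃ₗᵢ[ℝ] EuclideanSpace ℝ (Fin 3),
      S ∩ Metric.ball y (13 / 10 * a) = (fun n => y + A n) ''
        {p : EuclideanSpace ℝ (Fin 3) | p ∈ hcpStacking a h ∧ ‖p‖ < 13 / 10 * a})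
    {c : EuclideanSpace ℝ (Fin 3)}
    (hc : S ∩ Metric.ball c (13 / 10 * a) = (fun n => c + n) ''
      (halfTurn '' {p : EuclideanSpace ℝ (Fin 3) | p ∈ hcpStacking a h ∧ ‖p‖ < 13 / 10 * a})) (i j : ℤ) :
    S ∩ Metric.ball (c + barlowPos a h alternatingHagg 0 i j) (13 / 10 * a) =
      (fun n => c + barlowPos a h alternatingHagg 0 i j + n) ''
        (halfTurn '' {p : EuclideanSpace ℝ (Fin 3) | p ∈ hcpStacking a h ∧ ‖p‖ < 13 / 10 * a}) := by
  set N := {p : EuclideanSpace ℝ (Fin 3) | p ∈ hcpStacking a h ∧ ‖p‖ < 13 / 10 * a} with hN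
  set Mu := (ℝ ∙ barlowPos a h alternatingHagg 0 1 0)ᗮ.reflection with hMu
  set Muv := (ℝ ∙ (barlowPos a h alternatingHagg 0 1 0 - barlowPos a h alternatingHagg 0 0 1))ᗮ.reflection
    with hMuv
  have hU : ∀ x, Mu x ∈ hcpStacking a h ↔ x ∈ hcpStacking a h := mirrorU_mem_iff ha.ne'
  have hUV : ∀ x, Muv x ∈ hcpStacking a h ↔ x ∈ hcpStacking a h := mirrorUV_mem_iff ha.ne'
  have hL0 : haggLabel alternatingHagg 0 = 0 := haggLabel_zero _
  -- the generic step, conjugated by the half-turn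
  have step : ∀ g : EuclideanSpace ℝ (Fin 3) ≃ₗᵢ[ℝ] EuclideanSpace ℝ (Fin 3),
      (∀ x, g x ∈ hcpStacking a h ↔ x ∈ hcpStacking a h) →
      ∀ z : EuclideanSpace ℝ (Fin 3), S ∩ Metric.ball z (13 / 10 * a) = (fun n => z + n) '' (halfTurn '' N) →
        S ∩ Metric.ball (z + halfTurn (g (barlowPos a h alternatingHagg 0 1 0))) (13 / 10 * a) =
          (fun n => z + halfTurn (g (barlowPos a h alternatingHagg 0 1 0)) + n) '' (halfTurn '' N) := by
    intro g hg z hz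
    have hgN : (g.trans halfTurn) '' N = halfTurn '' N := by
      rw [LinearIsometryEquiv.coe_trans, Set.image_comp, image_cluster_eq_of_mem_iff hg]
    have := inLayer_step_conj ha hh hh1 hh2 (g.trans halfTurn) hS (z := z) (by rw [hgN]; exact hz)
    rwa [hgN] at this
  refine plane_fill (M := halfTurn '' N) ?_ ?_ ?_ ?_ hc i j
  · intro z hz
    have e : halfTurn (Mu (barlowPos a h alternatingHagg 0 1 0)) = barlowPos a h alternatingHagg 0 1 0 := by
      rw [hMu, mirrorU_site ha.ne', hL0, halfTurn_site_zero]; norm_num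
    have := step Mu hU z hz
    rw [e] at this
    exact this
  · intro z hz
    have e : halfTurn ((LinearIsometryEquiv.refl ℝ _) (barlowPos a h alternatingHagg 0 1 0)) =
        barlowPos a h alternatingHagg 0 (-1) 0 := by
      rw [LinearIsometryEquiv.coe_refl, id, halfTurn_site_zero]; norm_num
    have := step (LinearIsometryEquiv.refl ℝ _) (fun x => Iff.rfl) z hz
    rw [e] at this
    exact this
  · intro z hz
    have e : halfTurn ((Mu.trans Muv) (barlowPos a h alternatingHagg 0 1 0)) =
        barlowPos a h alternatingHagg 0 0 1 := by
      rw [LinearIsometryEquiv.trans_apply, hMu, mirrorU_site ha.ne', hL0, hMuv, mirrorUV_site ha.ne',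
        halfTurn_site_zero]
      norm_num
    have := step (Mu.trans Muv) (trans_mem_iff hU hUV) z hz
    rw [e] at this
    exact this
  · intro z hz
    have e : halfTurn (Muv (barlowPos a h alternatingHagg 0 1 0)) = barlowPos a h alternatingHagg 0 0 (-1) := by
      rw [hMuv, mirrorUV_site ha.ne', halfTurn_site_zero]; norm_num
    have := step Muv hUV z hz
    rw [e] at this
    exact this

/-! ### The four interlayer moves -/

/-- From a cluster identity, the translate lies in `S`. [folklore] -/
theorem translate_subset_of_cluster {S M : Set (EuclideanSpace ℝ (Fin 3))} {z : EuclideanSpace ℝ (Fin 3)}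
    {r : ℝ} (hz : S ∩ Metric.ball z r = (fun n => z + n) '' M) : (fun n => z + n) '' M ⊆ S := by
  rw [← hz]; exact Set.inter_subset_left

/-- **Up from an even-type layer**: `Cl N` on the layer through `c` gives the twin cluster at
`c + w + h e₃`. [folklore] -/
theorem up_even (ha : 0 < a) (hh : 0 < h) (hh1 : 64 / 100 * a ^ 2 < h ^ 2)
    (hh2 : h ^ 2 < 69 / 100 * a ^ 2) {S : Set (EuclideanSpace ℝ (Fin 3))}
    (hS : ∀ y ∈ S, ∃ A : EuclideanSpace ℝ (Fin 3) ≃ₗᵢ[ℝ] EuclideanSpace ℝ (Fin 3),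
      S ∩ Metric.ball y (13 / 10 * a) = (fun n => y + A n) ''
        {p : EuclideanSpace ℝ (Fin 3) | p ∈ hcpStacking a h ∧ ‖p‖ < 13 / 10 * a})
    {c : EuclideanSpace ℝ (Fin 3)}
    (hc : ∀ i j : ℤ, S ∩ Metric.ball (c + barlowPos a h alternatingHagg 0 i j) (13 / 10 * a) =
      (fun n => c + barlowPos a h alternatingHagg 0 i j + n) ''
        {p : EuclideanSpace ℝ (Fin 3) | p ∈ hcpStacking a h ∧ ‖p‖ < 13 / 10 * a}) :
    S ∩ Metric.ball (c + barlowPos a h alternatingHagg 1 0 0) (13 / 10 * a) =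
      (fun n => c + barlowPos a h alternatingHagg 1 0 0 + n) ''
        (halfTurn '' {p : EuclideanSpace ℝ (Fin 3) | p ∈ hcpStacking a h ∧ ‖p‖ < 13 / 10 * a}) := by
  have h0 := hc 0 0
  rw [barlowPos_alternating_zero, add_zero] at h0
  exact interLayer_step ha hh hh1 hh2 hS (translate_subset_of_cluster h0)
    (translate_subset_of_cluster (hc 1 0)) (translate_subset_of_cluster (hc 0 1))

/-- **Down from an even-type layer**: the twin cluster at `c + w − h e₃` (conjugate by `σ_h`).
[folklore] -/
theorem down_even (ha : 0 < a) (hh : 0 < h) (hh1 : 64 / 100 * a ^ 2 < h ^ 2)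
    (hh2 : h ^ 2 < 69 / 100 * a ^ 2) {S : Set (EuclideanSpace ℝ (Fin 3))}
    (hS : ∀ y ∈ S, ∃ A : EuclideanSpace ℝ (Fin 3) ≃ₗᵢ[ℝ] EuclideanSpace ℝ (Fin 3),
      S ∩ Metric.ball y (13 / 10 * a) = (fun n => y + A n) ''
        {p : EuclideanSpace ℝ (Fin 3) | p ∈ hcpStacking a h ∧ ‖p‖ < 13 / 10 * a})
    {c : EuclideanSpace ℝ (Fin 3)}
    (hc : ∀ i j : ℤ, S ∩ Metric.ball (c + barlowPos a h alternatingHagg 0 i j) (13 / 10 * a) =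
      (fun n => c + barlowPos a h alternatingHagg 0 i j + n) ''
        {p : EuclideanSpace ℝ (Fin 3) | p ∈ hcpStacking a h ∧ ‖p‖ < 13 / 10 * a}) :
    S ∩ Metric.ball (c + barlowPos a h alternatingHagg (-1) 0 0) (13 / 10 * a) =
      (fun n => c + barlowPos a h alternatingHagg (-1) 0 0 + n) ''
        (halfTurn '' {p : EuclideanSpace ℝ (Fin 3) | p ∈ hcpStacking a h ∧ ‖p‖ < 13 / 10 * a}) := by
  set N := {p : EuclideanSpace ℝ (Fin 3) | p ∈ hcpStacking a h ∧ ‖p‖ < 13 / 10 * a} with hN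
  set Mh := (ℝ ∙ layerNormal h)ᗮ.reflection with hMh
  have hMN : Mh '' N = N := image_cluster_eq_of_mem_iff (mirrorH_mem_iff hh.ne') _
  have hMu : Mh (barlowPos a h alternatingHagg 0 1 0) = barlowPos a h alternatingHagg 0 1 0 := by
    rw [hMh, mirrorH_site hh.ne']; rfl
  have hMv : Mh (barlowPos a h alternatingHagg 0 0 1) = barlowPos a h alternatingHagg 0 0 1 := by
    rw [hMh, mirrorH_site hh.ne']; rfl
  have hMp : Mh (barlowPos a h alternatingHagg 1 0 0) = barlowPos a h alternatingHagg (-1) 0 0 := by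
    rw [hMh, mirrorH_site hh.ne']
  have h0 := hc 0 0
  rw [barlowPos_alternating_zero, add_zero] at h0
  have := interLayer_step_conj ha hh hh1 hh2 Mh hS (z := c) (by rw [hMN]; exact translate_subset_of_cluster h0)
    (by rw [hMN, hMu]; exact translate_subset_of_cluster (hc 1 0))
    (by rw [hMN, hMv]; exact translate_subset_of_cluster (hc 0 1))
  rwa [hMp, hMh, mirrorH_image_twin hh.ne'] at this

/-- **Up from an odd-type layer**: `Cl (halfTurn N)` on the layer through `c` gives the cluster
`N` at `c − w + h e₃ = c + 𝔰 2 0 0 − 𝔰 1 0 0` (conjugate by the half-turn). [folklore] -/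
theorem up_odd (ha : 0 < a) (hh : 0 < h) (hh1 : 64 / 100 * a ^ 2 < h ^ 2)
    (hh2 : h ^ 2 < 69 / 100 * a ^ 2) {S : Set (EuclideanSpace ℝ (Fin 3))}
    (hS : ∀ y ∈ S, ∃ A : EuclideanSpace ℝ (Fin 3) ≃ₗᵢ[ℝ] EuclideanSpace ℝ (Fin 3),
      S ∩ Metric.ball y (13 / 10 * a) = (fun n => y + A n) ''
        {p : EuclideanSpace ℝ (Fin 3) | p ∈ hcpStacking a h ∧ ‖p‖ < 13 / 10 * a})
    {c : EuclideanSpace ℝ (Fin 3)}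
    (hc : ∀ i j : ℤ, S ∩ Metric.ball (c + barlowPos a h alternatingHagg 0 i j) (13 / 10 * a) =
      (fun n => c + barlowPos a h alternatingHagg 0 i j + n) ''
        (halfTurn '' {p : EuclideanSpace ℝ (Fin 3) | p ∈ hcpStacking a h ∧ ‖p‖ < 13 / 10 * a})) :
    S ∩ Metric.ball (c + (barlowPos a h alternatingHagg 2 0 0 - barlowPos a h alternatingHagg 1 0 0))
        (13 / 10 * a) =
      (fun n => c + (barlowPos a h alternatingHagg 2 0 0 - barlowPos a h alternatingHagg 1 0 0) + n) ''
        {p : EuclideanSpace ℝ (Fin 3) | p ∈ hcpStacking a h ∧ ‖p‖ < 13 / 10 * a} := by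
  set N := {p : EuclideanSpace ℝ (Fin 3) | p ∈ hcpStacking a h ∧ ‖p‖ < 13 / 10 * a} with hN
  have hTu : halfTurn (barlowPos a h alternatingHagg 0 1 0) = barlowPos a h alternatingHagg 0 (-1) 0 := by
    rw [halfTurn_site_zero]; norm_num
  have hTv : halfTurn (barlowPos a h alternatingHagg 0 0 1) = barlowPos a h alternatingHagg 0 0 (-1) := by
    rw [halfTurn_site_zero]; norm_num
  have hTp : halfTurn (barlowPos a h alternatingHagg 1 0 0) =
      barlowPos a h alternatingHagg 2 0 0 - barlowPos a h alternatingHagg 1 0 0 := by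
    rw [halfTurn_site]; norm_num
  have h0 := hc 0 0
  rw [barlowPos_alternating_zero, add_zero] at h0
  have := interLayer_step_conj ha hh hh1 hh2 halfTurn hS (z := c) (translate_subset_of_cluster h0)
    (by rw [hTu]; exact translate_subset_of_cluster (hc (-1) 0))
    (by rw [hTv]; exact translate_subset_of_cluster (hc 0 (-1)))
  rwa [hTp, halfTurn_image_image] at this

/-- **Down from an odd-type layer**: the cluster `N` at `c − w − h e₃ = c − 𝔰 1 0 0` (conjugate by
`halfTurn ∘ σ_h`). [folklore] -/
theorem down_odd (ha : 0 < a) (hh : 0 < h) (hh1 : 64 / 100 * a ^ 2 < h ^ 2)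
    (hh2 : h ^ 2 < 69 / 100 * a ^ 2) {S : Set (EuclideanSpace ℝ (Fin 3))}
    (hS : ∀ y ∈ S, ∃ A : EuclideanSpace ℝ (Fin 3) ≃ₗᵢ[ℝ] EuclideanSpace ℝ (Fin 3),
      S ∩ Metric.ball y (13 / 10 * a) = (fun n => y + A n) ''
        {p : EuclideanSpace ℝ (Fin 3) | p ∈ hcpStacking a h ∧ ‖p‖ < 13 / 10 * a})
    {c : EuclideanSpace ℝ (Fin 3)}
    (hc : ∀ i j : ℤ, S ∩ Metric.ball (c + barlowPos a h alternatingHagg 0 i j) (13 / 10 * a) =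
      (fun n => c + barlowPos a h alternatingHagg 0 i j + n) ''
        (halfTurn '' {p : EuclideanSpace ℝ (Fin 3) | p ∈ hcpStacking a h ∧ ‖p‖ < 13 / 10 * a})) :
    S ∩ Metric.ball (c + -barlowPos a h alternatingHagg 1 0 0) (13 / 10 * a) =
      (fun n => c + -barlowPos a h alternatingHagg 1 0 0 + n) ''
        {p : EuclideanSpace ℝ (Fin 3) | p ∈ hcpStacking a h ∧ ‖p‖ < 13 / 10 * a} := by
  set N := {p : EuclideanSpace ℝ (Fin 3) | p ∈ hcpStacking a h ∧ ‖p‖ < 13 / 10 * a} with hN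
  set Mh := (ℝ ∙ layerNormal h)ᗮ.reflection with hMh
  set g := Mh.trans halfTurn with hg
  have hMN : Mh '' N = N := image_cluster_eq_of_mem_iff (mirrorH_mem_iff hh.ne') _
  have hgN : g '' N = halfTurn '' N := by
    rw [hg, LinearIsometryEquiv.coe_trans, Set.image_comp, hMN]
  have hgN' : g '' (halfTurn '' N) = N := by
    rw [hg, LinearIsometryEquiv.coe_trans, Set.image_comp, hMh, mirrorH_image_twin hh.ne',
      halfTurn_image_image]
  have hgu : g (barlowPos a h alternatingHagg 0 1 0) = barlowPos a h alternatingHagg 0 (-1) 0 := by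
    rw [hg, LinearIsometryEquiv.trans_apply, hMh, mirrorH_site hh.ne', neg_zero, halfTurn_site_zero]
    norm_num
  have hgv : g (barlowPos a h alternatingHagg 0 0 1) = barlowPos a h alternatingHagg 0 0 (-1) := by
    rw [hg, LinearIsometryEquiv.trans_apply, hMh, mirrorH_site hh.ne', neg_zero, halfTurn_site_zero]
    norm_num
  have hgp : g (barlowPos a h alternatingHagg 1 0 0) = -barlowPos a h alternatingHagg 1 0 0 := by
    rw [hg, LinearIsometryEquiv.trans_apply, hMh, mirrorH_site hh.ne', halfTurn_site]
    norm_num [barlowPos_alternating_zero]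
  have h0 := hc 0 0
  rw [barlowPos_alternating_zero, add_zero] at h0
  have := interLayer_step_conj ha hh hh1 hh2 g hS (z := c) (by rw [hgN]; exact translate_subset_of_cluster h0)
    (by rw [hgN, hgu]; exact translate_subset_of_cluster (hc (-1) 0))
    (by rw [hgN, hgv]; exact translate_subset_of_cluster (hc 0 (-1)))
  rwa [hgp, hgN'] at this

end Layers

end Summit.AtomisticToContinuum.Crystallization.Theorems.ExactHcpLocal

end
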